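import Literature.Topology.CoveringSpaces.CoveringConnectedClassification
import Literature.Topology.CoveringSpaces.CoveringMapFibreFunctor
import Literature.Geometry.Kaehler.ComplexTorusDeckTransformations
import Mathlib.GroupTheory.QuotientGroup.Basic
import HarnessLib

/-!
# Deck transformations of a path-connected covering: normal coverings and `G(E) ≅ N(H)/H` (Hatcher, §1.3, Prop. 1.39)

Topic `Literature/Topology/CoveringSpaces`; campaign-L R1 (topological Galois correspondence for
covering maps), part (B) «connected covers», file 3. Everything is PROVED (no definition, no named
fact) from files 1–2 of part (B) (`CoveringMonodromyStabilizer`, `CoveringConnectedClassification`),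
the naturality of monodromy under morphisms of covers (`CoverMorphism.monodromy_fibreMap`, part (A))
and Mathlib; the GROUP of deck transformations is the tree's
`Literature.Geometry.Kaehler.ComplexTorus.deckTransformations p : Subgroup (E ≃ₜ E)` (the
self-homeomorphisms `f` with `p ∘ f = p`, defined there for an arbitrary map and used for complex
tori; here for a general covering map), with its `deck_eq_of_apply_eq` («a deck transformation of a
connected covering is determined by the image of one point»).

Setting (Hatcher, Prop. 1.39): `p : E → X` a covering map with `E` path connected and locally path
connected, `e₀ ∈ p⁻¹(x₀)`, `H := p_* π₁(E, e₀) = (FundamentalGroup.mapOfEq ⟨p, _⟩ e₀.2).range`,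
`N(H)` its normalizer in `π₁(X, x₀)`; `π₁(X, x₀)` acts on the fibre by Mathlib's monodromy
(`γ • e = hp.monodromy γ e`, the end point of the lift of `γ` from `e`).

* `exists_deck_apply_eq_iff_range_eq` — a deck transformation taking `e` to `e'` (same fibre)
  exists iff `p_* π₁(E, e) = p_* π₁(E, e')` (Prop. 1.37 with `E₁ = E₂ = E`);
  `exists_deck_apply_eq_monodromy_iff_mem_normalizer` — one taking `e₀` to `γ • e₀` exists iff
  `γ ∈ N(H)`;
* `exists_deck_apply_eq_of_fibre` — transitivity of `G(E)` on ONE nonempty fibre implies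
  transitivity on every fibre (deck transformations commute with monodromy along paths);
* `forall_exists_deck_apply_eq_iff_normal` — **Prop. 1.39 (a)**: the covering is NORMAL (for all
  `x` and all `e, e'` over `x` some deck transformation takes `e` to `e'`) iff `H ⊴ π₁(X, x₀)`;
* `exists_monoidHom_normalizer` — **Prop. 1.39 (b), the homomorphism**: there is a group
  homomorphism `φ : N(H) → (E ≃ₜ E)` with image EXACTLY `G(E)`, kernel EXACTLY `H`, characterised
  by `φ γ (γ • e₀) = e₀` (equivalently `φ γ e₀ = γ⁻¹ • e₀`). CONVENTION: Mathlib's `π₁` multiplies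
  paths in the REVERSE order (`FundamentalGroup.mul_def : γ * γ' = γ'.trans γ`), so Hatcher's
  assignment «`γ ↦` the deck transformation taking `e₀` to `γ̃(1) = γ • e₀`» is an
  ANTI-homomorphism here (as in Mathlib's `IsQuotientCoveringMap.fundamentalGroupEquiv :
  π₁ ≃* Gᵐᵒᵖ`); composing with inversion gives the homomorphism `φ` recorded;
* `nonempty_mulEquiv_normalizer_quotient` — **`N(H)/H ≅ G(E)`**;
  `nonempty_mulEquiv_quotient_of_normal` — for a normal covering `π₁(X, x₀)/H ≅ G(E)`;
  `natCard_deckTransformations_of_normal` — then `#G(E) = [π₁(X, x₀) : H] = #p⁻¹(x₀)`.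

## References

* A. Hatcher, *Algebraic Topology*, CUP 2002, §1.3 «Deck Transformations and Group Actions»,
  Prop. 1.39 (pp. 70–71). [HatcherAT2002]
-/

noncomputable section

open Function

namespace Literature.Topology.CoveringSpaces

namespace CoverDeck

open Literature.AlgebraicTopology.FundamentalGroup CoverMonodromy ConnectedCover
open Literature.Geometry.Kaehler.ComplexTorus (deckTransformations mem_deckTransformations_iff
  deck_eq_of_apply_eq deck_eq_one_of_apply_eq)

variable {E X : Type*} [TopologicalSpace E] [TopologicalSpace X] {p : E → X}

/-! ### §1 Deck transformations and monodromy -/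

/-- **Deck transformations commute with monodromy** along every path class (naturality,
`CoverMorphism.monodromy_fibreMap`): `f (γ • e) = γ • (f e)`.
[cite: HatcherAT2002, §1.3 Prop. 1.39] -/
theorem deck_monodromy (hp : IsCoveringMap p) {f : E ≃ₜ E} (hf : f ∈ deckTransformations p)
    {x y : X} (γ : Path.Homotopic.Quotient x y) (e : p ⁻¹' {x}) :
    f (hp.monodromy γ e) = hp.monodromy γ (CoverMorphism.fibreMap (p₂ := p) f hf x e) := by
  rw [CoverMorphism.monodromy_fibreMap hp hp f.continuous hf γ e]
  rfl

/-! ### §2 Which points are related by deck transformations -/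

section Connected

variable [PathConnectedSpace E] [LocallyPathConnectedSpace E]

/-- A deck transformation taking `e` to `e'` (two points of one fibre) exists iff
`p_* π₁(E, e) = p_* π₁(E, e')` (Hatcher, Prop. 1.37 applied with both coverings equal to `p`).
[cite: HatcherAT2002, §1.3 Prop. 1.39] -/
theorem exists_deck_apply_eq_iff_range_eq (hp : IsCoveringMap p) {x : X} (e e' : p ⁻¹' {x}) :
    (∃ f ∈ deckTransformations p, f e = e') ↔
      (FundamentalGroup.mapOfEq ⟨p, hp.continuous⟩ e.2).range =
        (FundamentalGroup.mapOfEq ⟨p, hp.continuous⟩ e'.2).range := by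
  rw [← exists_homeomorph_apply_eq_iff_range_mapOfEq_eq hp hp e e']
  exact ⟨fun ⟨f, hf, he⟩ => ⟨f, (mem_deckTransformations_iff p f).1 hf, he⟩,
    fun ⟨f, hf, he⟩ => ⟨f, (mem_deckTransformations_iff p f).2 hf, he⟩⟩

/-- A deck transformation taking `e₀` to `γ • e₀` exists iff `γ` normalises `H = p_* π₁(E, e₀)`
(Hatcher, proof of Prop. 1.39: «the stabiliser of `γ • e₀` is `γ H γ⁻¹`»).
[cite: HatcherAT2002, §1.3 Prop. 1.39] -/
theorem exists_deck_apply_eq_monodromy_iff_mem_normalizer (hp : IsCoveringMap p) {x₀ : X}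
    (e₀ : p ⁻¹' {x₀}) (γ : FundamentalGroup X x₀) :
    (∃ f ∈ deckTransformations p, f e₀ = hp.monodromy γ e₀) ↔
      γ ∈ Subgroup.normalizer
        ((FundamentalGroup.mapOfEq ⟨p, hp.continuous⟩ e₀.2).range : Set (FundamentalGroup X x₀)) := by
  rw [exists_deck_apply_eq_iff_range_eq hp e₀ (hp.monodromy γ e₀),
    range_mapOfEq_monodromy_eq_map_conj hp e₀ γ, Subgroup.mem_normalizer_iff_map_conj_eq,
    MulEquiv.toMonoidHom_eq_coe, eq_comm]

omit [LocallyPathConnectedSpace E] in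
/-- Transitivity of the deck group on ONE fibre containing a point `e₀` implies transitivity on
every fibre of the path-connected covering (carry both points to the fibre of `e₀` by monodromy
along a path, which commutes with deck transformations). [cite: HatcherAT2002, §1.3 Prop. 1.39] -/
theorem exists_deck_apply_eq_of_fibre (hp : IsCoveringMap p) {x₀ : X} (e₀ : p ⁻¹' {x₀})
    (h : ∀ e e' : p ⁻¹' {x₀}, ∃ f ∈ deckTransformations p, f e = e') {x : X}
    (e e' : p ⁻¹' {x}) : ∃ f ∈ deckTransformations p, f e = e' := by
  -- a path class from `x` to `x₀`: project a path in `E` from `e` to `e₀`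
  let Γ : Path (e : E) (e₀ : E) := PathConnectedSpace.somePath (e : E) (e₀ : E)
  let δ : Path.Homotopic.Quotient x x₀ :=
    Path.Homotopic.Quotient.mk ((Γ.map hp.continuous).cast e.2.symm e₀.2.symm)
  obtain ⟨f, hf, hfe⟩ := h (hp.monodromy δ e) (hp.monodromy δ e')
  refine ⟨f, hf, ?_⟩
  have key : hp.monodromy δ (CoverMorphism.fibreMap (p₂ := p) f hf x e) = hp.monodromy δ e' := by
    rw [CoverMorphism.monodromy_fibreMap hp hp f.continuous hf δ e]
    exact Subtype.ext hfe
  exact congr_arg Subtype.val ((hp.monodromy_bijective δ).1 key)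

/-- **Hatcher, Prop. 1.39 (a)**: a covering with path-connected, locally path-connected total
space is NORMAL — any two points of any fibre are related by a deck transformation — iff
`H = p_* π₁(E, e₀)` is a normal subgroup of `π₁(X, x₀)` (for one, equivalently every, base point
`e₀`). [cite: HatcherAT2002, §1.3 Prop. 1.39] -/
theorem forall_exists_deck_apply_eq_iff_normal (hp : IsCoveringMap p) {x₀ : X}
    (e₀ : p ⁻¹' {x₀}) :
    (∀ (x : X) (e e' : p ⁻¹' {x}), ∃ f ∈ deckTransformations p, f e = e') ↔
      (FundamentalGroup.mapOfEq ⟨p, hp.continuous⟩ e₀.2).range.Normal := by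
  rw [normal_range_mapOfEq_iff_forall hp e₀]
  constructor
  · intro h e'
    obtain ⟨f, hf, he⟩ := h x₀ e₀ e'
    exact (range_mapOfEq_eq_of_homeomorph hp hp f hf e₀ e' he).symm
  · intro h x e e'
    refine exists_deck_apply_eq_of_fibre hp e₀ (fun e₁ e₁' => ?_) e e'
    rw [exists_deck_apply_eq_iff_range_eq hp, h e₁, h e₁']

/-- Normality tested on the single fibre over `x₀`: the deck group is transitive on `p⁻¹(x₀)` iff
`p_* π₁(E, e₀) ⊴ π₁(X, x₀)`. [cite: HatcherAT2002, §1.3 Prop. 1.39] -/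
theorem forall_exists_deck_apply_eq_fibre_iff_normal (hp : IsCoveringMap p) {x₀ : X}
    (e₀ : p ⁻¹' {x₀}) :
    (∀ e e' : p ⁻¹' {x₀}, ∃ f ∈ deckTransformations p, f e = e') ↔
      (FundamentalGroup.mapOfEq ⟨p, hp.continuous⟩ e₀.2).range.Normal := by
  rw [← forall_exists_deck_apply_eq_iff_normal hp e₀]
  exact ⟨fun h x e e' => exists_deck_apply_eq_of_fibre hp e₀ h e e', fun h e e' => h x₀ e e'⟩

/-! ### §3 Prop. 1.39 (b): the homomorphism `N(H) → G(E)` and `G(E) ≅ N(H)/H` -/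

/-- **Hatcher, Prop. 1.39 (b) — the homomorphism.** For a covering `p : E → X` with
path-connected, locally path-connected total space and `H = p_* π₁(E, e₀)`: there is a group
homomorphism `φ` from the normalizer `N(H) ≤ π₁(X, x₀)` to the self-homeomorphisms of `E` whose
image is exactly the deck group `G(E)`, whose kernel is exactly `H`, and which sends `γ` to THE
deck transformation carrying `γ • e₀` (the end point of the lift of `γ` from `e₀`) back to `e₀`.
(With Mathlib's reversed multiplication on `π₁`, Hatcher's `γ ↦ (e₀ ↦ γ • e₀)` is the
anti-homomorphism `γ ↦ φ γ⁻¹`.) [cite: HatcherAT2002, §1.3 Prop. 1.39] -/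
theorem exists_monoidHom_normalizer (hp : IsCoveringMap p) {x₀ : X} (e₀ : p ⁻¹' {x₀}) :
    ∃ φ : Subgroup.normalizer ((FundamentalGroup.mapOfEq ⟨p, hp.continuous⟩ e₀.2).range :
        Set (FundamentalGroup X x₀)) →* (E ≃ₜ E),
      φ.range = deckTransformations p ∧
      φ.ker = ((FundamentalGroup.mapOfEq ⟨p, hp.continuous⟩ e₀.2).range).subgroupOf
        (Subgroup.normalizer ((FundamentalGroup.mapOfEq ⟨p, hp.continuous⟩ e₀.2).range :
          Set (FundamentalGroup X x₀))) ∧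
      ∀ γ, φ γ (hp.monodromy (γ : FundamentalGroup X x₀) e₀) = e₀ := by
  set H := (FundamentalGroup.mapOfEq ⟨p, hp.continuous⟩ e₀.2).range with hH
  -- for `γ ∈ N(H)` choose the deck transformation with `F γ (γ • e₀) = e₀`
  have hex : ∀ γ : Subgroup.normalizer (H : Set (FundamentalGroup X x₀)),
      ∃ f ∈ deckTransformations p, f (hp.monodromy (γ : FundamentalGroup X x₀) e₀) = e₀ := by
    intro γ
    rw [exists_deck_apply_eq_iff_range_eq hp, range_mapOfEq_monodromy_eq_map_conj hp e₀,
      MulEquiv.toMonoidHom_eq_coe]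
    exact Subgroup.mem_normalizer_iff_map_conj_eq.1 γ.2
  choose F hFmem hFapply using hex
  -- deck transformations commute with the monodromy of loops at `x₀`
  have hcomm : ∀ {f : E ≃ₜ E} (hf : f ∈ deckTransformations p) (γ : FundamentalGroup X x₀)
      (e : p ⁻¹' {x₀}),
      f (hp.monodromy γ e) = hp.monodromy γ (CoverMorphism.fibreMap (p₂ := p) f hf x₀ e) :=
    fun hf γ e => deck_monodromy hp hf γ e
  have hmul : ∀ γ γ' : FundamentalGroup X x₀,
      hp.monodromy (γ * γ') e₀ = hp.monodromy γ (hp.monodromy γ' e₀) := fun γ γ' => by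
    rw [FundamentalGroup.mul_def]
    exact hp.monodromy_trans_apply _ _ e₀
  let φ : Subgroup.normalizer (H : Set (FundamentalGroup X x₀)) →* (E ≃ₜ E) :=
    { toFun := F
      map_one' := by
        refine deck_eq_one_of_apply_eq hp (hFmem 1) (y := (e₀ : E)) ?_
        have h1 := hFapply 1
        rwa [OneMemClass.coe_one, FundamentalGroup.one_def, hp.monodromy_refl] at h1
      map_mul' := fun γ γ' => by
        refine deck_eq_of_apply_eq hp (hFmem (γ * γ')) (mul_mem (hFmem γ) (hFmem γ'))
          (y := (hp.monodromy ((γ * γ').1 : FundamentalGroup X x₀) e₀ : E)) ?_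
        rw [hFapply (γ * γ'), Homeomorph.mul_apply, Subgroup.coe_mul, hmul,
          hcomm (hFmem γ') (γ : FundamentalGroup X x₀)]
        have h' : CoverMorphism.fibreMap (p₂ := p) (F γ') (hFmem γ') x₀
            (hp.monodromy (γ' : FundamentalGroup X x₀) e₀) = e₀ := Subtype.ext (hFapply γ')
        rw [h', hFapply γ] }
  have hφ : ∀ γ, φ γ = F γ := fun _ => rfl
  refine ⟨φ, ?_, ?_, fun γ => hFapply γ⟩
  · -- the image is the whole deck group
    ext f
    constructor
    · rintro ⟨γ, rfl⟩
      exact hFmem γ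
    · intro hf
      -- `f⁻¹ e₀` lies over `x₀`; reach it from `e₀` by monodromy along some `γ`
      have hf' := (mem_deckTransformations_iff p f).1 hf
      let e₁ : p ⁻¹' {x₀} := ⟨f.symm e₀, by
        rw [Set.mem_preimage, ← hf' (f.symm e₀), f.apply_symm_apply]; exact e₀.2⟩
      obtain ⟨γ, hγ⟩ := exists_monodromy_eq hp e₀ e₁
      have hγN : γ ∈ Subgroup.normalizer (H : Set (FundamentalGroup X x₀)) := by
        rw [Subgroup.mem_normalizer_iff_map_conj_eq, ← MulEquiv.toMonoidHom_eq_coe, hH,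
          ← range_mapOfEq_monodromy_eq_map_conj hp e₀ γ, hγ]
        exact range_mapOfEq_eq_of_homeomorph hp hp f hf' e₁ e₀ (f.apply_symm_apply _)
      refine ⟨⟨γ, hγN⟩, deck_eq_of_apply_eq hp (hFmem _) hf (y := (hp.monodromy γ e₀ : E)) ?_⟩
      rw [hφ, hFapply ⟨γ, hγN⟩, hγ]
      exact (f.apply_symm_apply _).symm
  · -- the kernel is `H`
    ext γ
    rw [MonoidHom.mem_ker, Subgroup.mem_subgroupOf]
    change φ γ = 1 ↔
      (γ : FundamentalGroup X x₀) ∈ (FundamentalGroup.mapOfEq ⟨p, hp.continuous⟩ e₀.2).range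
    rw [mem_range_mapOfEq_iff_monodromy_eq hp e₀]
    constructor
    · intro h1
      have h := hFapply γ
      rw [← hφ, h1, Homeomorph.one_apply] at h
      exact Subtype.ext h
    · intro h
      refine deck_eq_one_of_apply_eq hp (hFmem γ) (y := (e₀ : E)) ?_
      have h' := hFapply γ
      rwa [h] at h'

/-- **Hatcher, Prop. 1.39 (b)**: for a covering with path-connected, locally path-connected total
space, the deck group `G(E)` is isomorphic to `N(H)/H`, `H = p_* π₁(E, e₀)`.
[cite: HatcherAT2002, §1.3 Prop. 1.39] -/
theorem nonempty_mulEquiv_normalizer_quotient (hp : IsCoveringMap p) {x₀ : X} (e₀ : p ⁻¹' {x₀}) :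
    Nonempty
      ((Subgroup.normalizer ((FundamentalGroup.mapOfEq ⟨p, hp.continuous⟩ e₀.2).range :
          Set (FundamentalGroup X x₀)) ⧸
        ((FundamentalGroup.mapOfEq ⟨p, hp.continuous⟩ e₀.2).range).subgroupOf
          (Subgroup.normalizer ((FundamentalGroup.mapOfEq ⟨p, hp.continuous⟩ e₀.2).range :
            Set (FundamentalGroup X x₀)))) ≃* deckTransformations p) := by
  obtain ⟨φ, hrange, hker, -⟩ := exists_monoidHom_normalizer hp e₀
  exact ⟨(QuotientGroup.quotientMulEquivOfEq hker.symm).trans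
    ((QuotientGroup.quotientKerEquivRange φ).trans (MulEquiv.subgroupCongr hrange))⟩

/-- **Prop. 1.39 (b), normal case**: for a NORMAL covering (`H = p_* π₁(E, e₀) ⊴ π₁(X, x₀)`)
with path-connected, locally path-connected total space there is a homomorphism of ALL of
`π₁(X, x₀)` onto the deck group with kernel `H`, `γ ↦` the deck transformation carrying `γ • e₀`
to `e₀`. [cite: HatcherAT2002, §1.3 Prop. 1.39] -/
theorem exists_monoidHom_of_normal (hp : IsCoveringMap p) {x₀ : X} (e₀ : p ⁻¹' {x₀})
    (hN : (FundamentalGroup.mapOfEq ⟨p, hp.continuous⟩ e₀.2).range.Normal) :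
    ∃ ψ : FundamentalGroup X x₀ →* (E ≃ₜ E),
      ψ.range = deckTransformations p ∧
      ψ.ker = (FundamentalGroup.mapOfEq ⟨p, hp.continuous⟩ e₀.2).range ∧
      ∀ γ, ψ γ (hp.monodromy γ e₀) = e₀ := by
  set H := (FundamentalGroup.mapOfEq ⟨p, hp.continuous⟩ e₀.2).range with hH
  obtain ⟨φ, hrange, hker, happly⟩ := exists_monoidHom_normalizer hp e₀
  have htop : Subgroup.normalizer (H : Set (FundamentalGroup X x₀)) = ⊤ :=
    haveI := hN; Subgroup.normalizer_eq_top H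
  -- `π₁(X, x₀) ≅ ⊤ = N(H)`
  let ι : FundamentalGroup X x₀ →* Subgroup.normalizer (H : Set (FundamentalGroup X x₀)) :=
    (Subgroup.inclusion htop.ge).comp Subgroup.topEquiv.symm.toMonoidHom
  have hι : ∀ γ, (ι γ : FundamentalGroup X x₀) = γ := fun γ => rfl
  have hιsurj : Function.Surjective ι := fun γ => ⟨γ, Subtype.ext (hι γ)⟩
  refine ⟨φ.comp ι, ?_, ?_, fun γ => ?_⟩
  · rw [MonoidHom.range_comp, MonoidHom.range_eq_top.2 hιsurj, ← MonoidHom.range_eq_map, hrange]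
  · ext γ
    rw [MonoidHom.mem_ker, MonoidHom.comp_apply, ← MonoidHom.mem_ker, hker, Subgroup.mem_subgroupOf,
      hι]
  · rw [MonoidHom.comp_apply, ← hι γ]
    exact happly (ι γ)

/-- **Prop. 1.39 (b), normal case**: `G(E) ≅ π₁(X, x₀)/H` for a normal covering.
[cite: HatcherAT2002, §1.3 Prop. 1.39] -/
theorem nonempty_mulEquiv_quotient_of_normal (hp : IsCoveringMap p) {x₀ : X} (e₀ : p ⁻¹' {x₀})
    (hN : (FundamentalGroup.mapOfEq ⟨p, hp.continuous⟩ e₀.2).range.Normal) :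
    Nonempty ((FundamentalGroup X x₀ ⧸ (FundamentalGroup.mapOfEq ⟨p, hp.continuous⟩ e₀.2).range) ≃*
      deckTransformations p) := by
  obtain ⟨ψ, hrange, hker, -⟩ := exists_monoidHom_of_normal hp e₀ hN
  haveI := hN
  exact ⟨(QuotientGroup.quotientMulEquivOfEq hker.symm).trans
    ((QuotientGroup.quotientKerEquivRange ψ).trans (MulEquiv.subgroupCongr hrange))⟩

/-- For a normal covering with path-connected, locally path-connected total space, the order of
the deck group is the index `[π₁(X, x₀) : H]`, i.e. the number of sheets (Hatcher, Prop. 1.39 with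
Prop. 1.32; as `Nat.card`, `0` when infinite). [cite: HatcherAT2002, §1.3 Prop. 1.39] -/
theorem natCard_deckTransformations_of_normal (hp : IsCoveringMap p) {x₀ : X} (e₀ : p ⁻¹' {x₀})
    (hN : (FundamentalGroup.mapOfEq ⟨p, hp.continuous⟩ e₀.2).range.Normal) :
    Nat.card (deckTransformations p) =
      (FundamentalGroup.mapOfEq ⟨p, hp.continuous⟩ e₀.2).range.index ∧
    Nat.card (deckTransformations p) = Nat.card (p ⁻¹' {x₀}) := by
  obtain ⟨e⟩ := nonempty_mulEquiv_quotient_of_normal hp e₀ hN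
  have h1 : Nat.card (deckTransformations p) =
      (FundamentalGroup.mapOfEq ⟨p, hp.continuous⟩ e₀.2).range.index := by
    rw [Subgroup.index_eq_card, Nat.card_congr e.toEquiv]
  exact ⟨h1, h1.trans (index_range_mapOfEq_eq_natCard_fiber hp e₀)⟩

end Connected

end CoverDeck

end Literature.Topology.CoveringSpaces
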